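import Summits.QuantumFields.BalabanUV.T4Continuum.Support.RegionCollarFold

/-!
# `BalabanUV.T4Continuum.Support.RegionCollarCutoff` — NE2 (node U1a) formalisation swarm, SUPPLIER item «Δ1-VEC-W1-HOLED» under the
# owner's sub-row `T4-U1a.S-NE2-D1-DIRICHLET°` (vector layer W1), file 2/3: THE COLLAR CUTOFF `χ` AND THE LIFT `λ = χ·(g ∘ F)` OF A SCALAR
# FROM THE BLOCK `w` TO ITS COLLAR, WITH ITS GRADIENT BOUNDED BY THE BLOCK DATA OF `g` «not in print; our construction»
# (unit b2b-balaban-t4-ne2-formalise-leaf-09, gen 9, v1)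

HONEST FRAMING (T4-DAG p. 1).  [folklore] lattice bookkeeping + one elementary estimate: `χ = Π_μ ψ(koff_μ, j_μ)` with the profile
`ψ(0,t) = t/n`, `ψ(1,·) = 1`, `ψ(2,t) = (n−1−t)/n`, `ψ(k ≥ 3, ·) = 0` (so `χ = 1` on `w`, `χ = 0` off the collar and on its outer layer,
`|χ(x + e_ρ) − χ(x)| ≤ 1/n`); the LIFT `lift g = χ·(g ∘ F)` of a scalar `g` equals `g` on `w`; and **`nsq_grad_lift_le`**:
`nsq (∂ (lift g)) ≤ 2·3^d·Σ_ρ Σ_{j : j_ρ+1<n} ‖(∂_ρ g)(bpt w j)‖² + 2d·3^d·Σ_j ‖g (bpt w j)‖²` — the gradient of the lift is paid by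
the gradient of `g` INSIDE `w` and the mass of `g` on `w` (each sub-block of the collar reads `w` once through the fold; the cutoff
spends its unit slope on the mass).  `3 ≤ M_ν` (the collar blocks are distinct).  Nothing printed is a hypothesis; NE2 (U1a) NOT proved;
spine PROVED 0/9 unchanged; NOT [B9] (3.23)–(3.27) as printed; NOT infinite volume, NOT the mass gap, NOT Clay.  HONEST DEPENDENCY
(verbatim): «continuum YM on T⁴ ⇐ BetaPertH ∧ nine spine estimates (0/9 proved); BetaPertH ⇐ (D1) ∧ (D4) ∧ CAP+tail; G-an2-4 gates
asym, D1 and NE2/3/4.»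

ABSOLUTE RULE (cell, verbatim): «No internally-minted statement may enter as a cited fact. Every hypothesis is either kernel-proved in
this package or a verbatim quotation of a PUBLISHED theorem with page reference. The manuscript(s) under audit are NOT citable for
their own disputed steps — they are the thing under adjudication; programme-internal (2001/route/tribunal) claims are never citable.»
[folklore] throughout; data defs `psi`, `chi`, `lift`, `Pfac`; no `def … : Prop`.  NOT CLAIMED: anything about the operator yet; NE2; NE3.
-/

noncomputable section

open scoped BigOperators ComplexConjugate Matrix
open Finset

namespace Summit.QuantumFields.BalabanUV.T4Continuum.RegionCollarCutoff

open Literature.MathematicalPhysics.QuantumFieldTheory.Balaban1983to89.B5Prop11Plancherel (Tor fine unitVec)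
open Literature.MathematicalPhysics.QuantumFieldTheory.Balaban1983to89.B5Prop11Lower (nsq nsq_nonneg)
open Literature.MathematicalPhysics.QuantumFieldTheory.Balaban1983to89.B5Action121 (GradOp GradOp_mulVec sdiff sdiff_mulVec)
open Literature.MathematicalPhysics.QuantumFieldTheory.Balaban1983to89.B5Block118 (bpt)
open Literature.MathematicalPhysics.QuantumFieldTheory.Balaban1983to89.B5Blocks16 (blockOf blockOf_bpt)
open Summit.QuantumFields.BalabanUV.T4Continuum
open Summit.QuantumFields.BalabanUV.T4Continuum.ScalarBlockTrialFunction (digits digits_bpt bpt_add_unitVec_of_lt)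
open Summit.QuantumFields.BalabanUV.T4Continuum.RegionGaugeFixedVectorFlat (bpt_blockOf_digits)
open Summit.QuantumFields.BalabanUV.T4Continuum.RegionCollarFold

variable {d : ℕ} (n : ℕ) [NeZero n] (M : Fin d → ℕ) [hM : ∀ μ, NeZero (M μ)] (w : Tor M)

/-! ## §1 The profile and the cutoff -/

/-- the one-dimensional profile across the three collar blocks of a direction. [folklore] -/
def psi (k t : ℕ) : ℝ := if k = 0 then (t : ℝ) / n else if k = 1 then 1 else if k = 2 then ((n : ℝ) - 1 - t) / n else 0

/-- **THE COLLAR CUTOFF** `χ(x) = Π_μ ψ(koff_μ x, digit_μ x)`. [folklore] -/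
def chi (x : Tor (fine n M)) : ℝ := ∏ μ, psi n (koff n M w x μ) (digits n M x μ : ℕ)

/-- the product of the profile factors off one direction. [folklore] -/
def Pfac (x : Tor (fine n M)) (ρ : Fin d) : ℝ := ∏ μ ∈ univ.erase ρ, psi n (koff n M w x μ) (digits n M x μ : ℕ)

omit [NeZero n] in
/-- `0 ≤ ψ ≤ 1` on digits `t < n`. [folklore] -/
theorem psi_nonneg {k t : ℕ} (ht : t < n) : 0 ≤ psi n k t := by
  have hn : (0 : ℝ) < n := by exact_mod_cast (Nat.zero_lt_of_lt ht)
  have ht' : (t : ℝ) + 1 ≤ n := by exact_mod_cast ht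
  unfold psi
  split_ifs
  · positivity
  · norm_num
  · apply div_nonneg _ hn.le; linarith
  · exact le_rfl

omit [NeZero n] in
/-- `ψ ≤ 1`. [folklore] -/
theorem psi_le_one {k t : ℕ} (ht : t < n) : psi n k t ≤ 1 := by
  have hn : (0 : ℝ) < n := by exact_mod_cast (Nat.zero_lt_of_lt ht)
  have ht' : (t : ℝ) + 1 ≤ n := by exact_mod_cast ht
  unfold psi
  split_ifs
  · rw [div_le_one hn]; linarith
  · exact le_rfl
  · rw [div_le_one hn]; linarith [Nat.cast_nonneg (α := ℝ) t]
  · norm_num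

omit [NeZero n] in
/-- `ψ(1, ·) = 1`. [folklore] -/
theorem psi_one (t : ℕ) : psi n 1 t = 1 := by simp [psi]

omit [NeZero n] in
/-- `ψ(k, ·) = 0` for `k ≥ 3`. [folklore] -/
theorem psi_of_three_le {k : ℕ} (hk : 3 ≤ k) (t : ℕ) : psi n k t = 0 := by
  unfold psi
  rw [if_neg (by omega), if_neg (by omega), if_neg (by omega)]

omit [NeZero n] in
/-- `ψ(0, 0) = 0` (the outer layer below). [folklore] -/
theorem psi_zero_zero : psi n 0 0 = 0 := by simp [psi]

omit [NeZero n] in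
/-- `ψ(2, n−1) = 0` (the outer layer above). [folklore] -/
theorem psi_two_last {t : ℕ} (ht : t + 1 = n) : psi n 2 t = 0 := by
  have : ((n : ℝ) - 1 - t) = 0 := by
    have h : (t : ℝ) + 1 = n := by exact_mod_cast ht
    linarith
  simp [psi, this]

omit [NeZero n] in
/-- **THE PROFILE IS `1/n`-LIPSCHITZ INSIDE A BLOCK**. [folklore] -/
theorem psi_step_le (k : ℕ) {t : ℕ} (ht : t + 1 < n) : |psi n k (t + 1) - psi n k t| ≤ 1 / n := by
  have hn : (0 : ℝ) < n := by exact_mod_cast (Nat.zero_lt_of_lt ht)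
  unfold psi
  split_ifs
  · rw [Nat.cast_succ, add_div, add_sub_cancel_left, abs_of_nonneg (by positivity)]
  · simp
  · rw [Nat.cast_succ, show ((n : ℝ) - 1 - (t + 1)) / n - ((n : ℝ) - 1 - t) / n = -(1 / n) by ring, abs_neg,
      abs_of_nonneg (by positivity)]
  · simp

omit [NeZero n] in
/-- **… AND ACROSS THE TWO INTERFACES** (`k ∈ {0,1}`, from digit `n−1` of block `k` to digit `0` of block `k+1`). [folklore] -/
theorem psi_cross_le {k t : ℕ} (hk : k + 1 < 3) (ht : t + 1 = n) : |psi n (k + 1) 0 - psi n k t| ≤ 1 / n := by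
  have hn : (0 : ℝ) < n := by have : 0 < n := by omega
                              exact_mod_cast this
  have ht' : (t : ℝ) = n - 1 := by have h : (t : ℝ) + 1 = n := by exact_mod_cast ht
                                   linarith
  have hk2 : k = 0 ∨ k = 1 := by omega
  rcases hk2 with h0 | h1
  · subst h0
    simp only [psi, zero_add, if_true, one_ne_zero, if_false, ht', Nat.cast_zero]
    rw [show (1 : ℝ) - (n - 1) / n = 1 / n by field_simp; ring, abs_of_nonneg (by positivity)]
  · subst h1
    simp only [psi, if_true, one_ne_zero, if_false, Nat.cast_zero, show (1 + 1 : ℕ) = 2 from rfl, sub_zero,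
      show (2 : ℕ) ≠ 0 from two_ne_zero, show (2 : ℕ) ≠ 1 from by norm_num]
    rw [show ((n : ℝ) - 1) / n - 1 = -(1 / n) by field_simp; ring, abs_neg, abs_of_nonneg (by positivity)]

/-- `χ = ψ_ρ · P_ρ` (splitting off the direction `ρ`). [folklore] -/
theorem chi_eq_mul (x : Tor (fine n M)) (ρ : Fin d) :
    chi n M w x = psi n (koff n M w x ρ) (digits n M x ρ : ℕ) * Pfac n M w x ρ := by
  rw [chi, Pfac, ← Finset.mul_prod_erase univ _ (mem_univ ρ)]

/-- `0 ≤ P_ρ ≤ 1`. [folklore] -/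
theorem Pfac_nonneg (x : Tor (fine n M)) (ρ : Fin d) : 0 ≤ Pfac n M w x ρ :=
  prod_nonneg fun μ _ => psi_nonneg n (digits n M x μ).isLt

/-- `P_ρ ≤ 1`. [folklore] -/
theorem Pfac_le_one (x : Tor (fine n M)) (ρ : Fin d) : Pfac n M w x ρ ≤ 1 :=
  prod_le_one (fun μ _ => psi_nonneg n (digits n M x μ).isLt) fun μ _ => psi_le_one n (digits n M x μ).isLt

/-- `0 ≤ χ ≤ 1`. [folklore] -/
theorem chi_nonneg (x : Tor (fine n M)) : 0 ≤ chi n M w x := prod_nonneg fun μ _ => psi_nonneg n (digits n M x μ).isLt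

/-- `χ ≤ 1`. [folklore] -/
theorem chi_le_one (x : Tor (fine n M)) : chi n M w x ≤ 1 :=
  prod_le_one (fun μ _ => psi_nonneg n (digits n M x μ).isLt) fun μ _ => psi_le_one n (digits n M x μ).isLt

/-- **`χ = 1` ON `w`** (`2 ≤ M_ν`). [folklore] -/
theorem chi_of_blockOf_eq (hM2 : ∀ μ, 2 ≤ M μ) {x : Tor (fine n M)} (hx : blockOf n M x = w) : chi n M w x = 1 := by
  rw [chi]
  exact prod_eq_one fun μ _ => by rw [koff_of_blockOf_eq n M w hM2 hx, psi_one]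

/-- `χ = 0` as soon as one factor vanishes. [folklore] -/
theorem chi_eq_zero_of (x : Tor (fine n M)) {ν : Fin d} (h : psi n (koff n M w x ν) (digits n M x ν : ℕ) = 0) : chi n M w x = 0 :=
  prod_eq_zero (mem_univ ν) h

/-- **`χ = 0` OFF THE COLLAR**. [folklore] -/
theorem chi_eq_zero_of_not_mem {x : Tor (fine n M)} (hx : x ∉ collar n M w) : chi n M w x = 0 := by
  simp only [mem_collar, not_forall, not_lt] at hx
  obtain ⟨ν, hν⟩ := hx
  exact chi_eq_zero_of n M w x (psi_of_three_le n hν _)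

/-- the `P_ρ`-factor does not change under a `ρ`-step inside a block. [folklore] -/
theorem Pfac_add_unitVec_of_lt (x : Tor (fine n M)) (ρ : Fin d) (h : (digits n M x ρ : ℕ) + 1 < n) :
    Pfac n M w (x + unitVec (fine n M) ρ) ρ = Pfac n M w x ρ := by
  refine prod_congr rfl fun μ hμ => ?_
  have hne : μ ≠ ρ := ne_of_mem_erase hμ
  rw [koff_add_unitVec_of_lt n M w x ρ h, digits_add_unitVec_of_lt n M x ρ h, Function.update_of_ne hne]

/-- … nor under a `ρ`-step across a face. [folklore] -/
theorem Pfac_add_unitVec_of_eq (x : Tor (fine n M)) (ρ : Fin d) (h : (digits n M x ρ : ℕ) + 1 = n) :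
    Pfac n M w (x + unitVec (fine n M) ρ) ρ = Pfac n M w x ρ := by
  refine prod_congr rfl fun μ hμ => ?_
  have hne : μ ≠ ρ := ne_of_mem_erase hμ
  rw [koff_add_unitVec_of_ne n M w x hne, digits_add_unitVec_of_eq n M x ρ h, Function.update_of_ne hne]

/-! ## §2 The lift and its gradient, bond by bond -/

/-- **THE LIFT** of a scalar from `w` to the collar: `lift g = χ · (g ∘ F)`. [folklore] -/
def lift (g : Tor (fine n M) → ℂ) : Tor (fine n M) → ℂ := fun x => (chi n M w x : ℂ) * g (fold n M w x)

/-- **`lift g = g` ON `w`** (`2 ≤ M_ν`). [folklore] -/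
theorem lift_of_blockOf_eq (hM2 : ∀ μ, 2 ≤ M μ) (g : Tor (fine n M) → ℂ) {x : Tor (fine n M)} (hx : blockOf n M x = w) :
    lift n M w g x = g x := by
  rw [lift, chi_of_blockOf_eq n M w hM2 hx, fold_of_blockOf_eq n M w hM2 hx, Complex.ofReal_one, one_mul]

/-- `lift g = 0` off the collar. [folklore] -/
theorem lift_of_not_mem (g : Tor (fine n M) → ℂ) {x : Tor (fine n M)} (hx : x ∉ collar n M w) : lift n M w g x = 0 := by
  rw [lift, chi_eq_zero_of_not_mem n M w hx, Complex.ofReal_zero, zero_mul]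

omit [NeZero n] hM in
/-- the elementary inequality behind the product rule: `‖c′‖ ≤ 1`, `|c′ − c| ≤ 1/n` ⟹ `n²‖c′a′ − c a‖² ≤ 2 n²‖a′ − a‖² + 2‖a‖²`. [folklore] -/
theorem prod_rule_sq {c c' : ℝ} {a a' : ℂ} (hn : 0 < n) (hc' : |c'| ≤ 1) (hcc : |c' - c| ≤ 1 / n) :
    (n : ℝ) ^ 2 * ‖(c' : ℂ) * a' - (c : ℂ) * a‖ ^ 2 ≤ 2 * ((n : ℝ) ^ 2 * ‖a' - a‖ ^ 2) + 2 * ‖a‖ ^ 2 := by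
  have hn' : (0 : ℝ) < n := by exact_mod_cast hn
  have hsplit : (c' : ℂ) * a' - (c : ℂ) * a = (c' : ℂ) * (a' - a) + ((c' - c : ℝ) : ℂ) * a := by push_cast; ring
  have h1 : ‖(c' : ℂ) * a' - (c : ℂ) * a‖ ≤ ‖a' - a‖ + (1 / n) * ‖a‖ := by
    rw [hsplit]
    refine (norm_add_le _ _).trans ?_
    rw [norm_mul, norm_mul, Complex.norm_real, Complex.norm_real, Real.norm_eq_abs, Real.norm_eq_abs]
    gcongr
    · exact (mul_le_of_le_one_left (norm_nonneg _) hc')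
  have h2 : (n : ℝ) * ‖(c' : ℂ) * a' - (c : ℂ) * a‖ ≤ (n : ℝ) * ‖a' - a‖ + ‖a‖ := by
    have := mul_le_mul_of_nonneg_left h1 hn'.le
    rwa [mul_add, ← mul_assoc, mul_one_div_cancel hn'.ne', one_mul] at this
  have h0 : 0 ≤ (n : ℝ) * ‖(c' : ℂ) * a' - (c : ℂ) * a‖ := by positivity
  nlinarith [sq_nonneg ((n : ℝ) * ‖a' - a‖ - ‖a‖), norm_nonneg (a' - a), norm_nonneg a, sq_abs ((n:ℝ) * ‖(c' : ℂ) * a' - (c : ℂ) * a‖)]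

/-- the bond term of the lift at a collar site: `n²‖g(F(x+e_ρ)) − g(F x)‖²` on an interior step, `0` on a crossing. [folklore] -/
def Dterm (g : Tor (fine n M) → ℂ) (k : Fin d → Fin 3) (j : Fin d → Fin n) (ρ : Fin d) : ℝ :=
  if (j ρ : ℕ) + 1 < n then
    (n : ℝ) ^ 2 * ‖g (fold n M w (csite n M w k j + unitVec (fine n M) ρ)) - g (fold n M w (csite n M w k j))‖ ^ 2
  else 0

/-- `0 ≤ Dterm`. [folklore] -/
theorem Dterm_nonneg (g : Tor (fine n M) → ℂ) (k : Fin d → Fin 3) (j : Fin d → Fin n) (ρ : Fin d) : 0 ≤ Dterm n M w g k j ρ := by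
  unfold Dterm; split_ifs <;> positivity

/-- **THE GRADIENT OF THE LIFT AT A COLLAR SITE, BOND BY BOND** (`3 ≤ M_ν`):
`n²‖lift(x + e_ρ) − lift(x)‖² ≤ 2·Dterm + 2·‖g(F x)‖²`. [folklore] -/
theorem lift_step_sq_le (hM3 : ∀ μ, 3 ≤ M μ) (g : Tor (fine n M) → ℂ) (k : Fin d → Fin 3) (j : Fin d → Fin n) (ρ : Fin d) :
    (n : ℝ) ^ 2 * ‖lift n M w g (csite n M w k j + unitVec (fine n M) ρ) - lift n M w g (csite n M w k j)‖ ^ 2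
      ≤ 2 * Dterm n M w g k j ρ + 2 * ‖g (fold n M w (csite n M w k j))‖ ^ 2 := by
  have hM2 : ∀ μ, 2 ≤ M μ := fun μ => le_of_lt (hM3 μ)
  have hn : 0 < n := Nat.pos_of_ne_zero (NeZero.ne n)
  set x := csite n M w k j with hx
  have hkoff : ∀ ν, koff n M w x ν = k ν := koff_csite n M w hM3 k j
  have hdig : digits n M x = j := digits_csite n M w k j
  by_cases hlt : (j ρ : ℕ) + 1 < n
  · -- interior step: same block, `χ` moves by at most `1/n`
    rw [Dterm, if_pos hlt]
    have hlt' : (digits n M x ρ : ℕ) + 1 < n := by rw [hdig]; exact hlt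
    have hd' : (digits n M (x + unitVec (fine n M) ρ) ρ : ℕ) = (j ρ : ℕ) + 1 := by
      have h := congrArg (fun f : Fin d → Fin n => (f ρ : ℕ)) (digits_add_unitVec_of_lt n M x ρ hlt')
      simp only [Function.update_self] at h
      rw [h, hdig]
    have hchi' : chi n M w (x + unitVec (fine n M) ρ)
        = psi n (k ρ) ((j ρ : ℕ) + 1) * Pfac n M w x ρ := by
      rw [chi_eq_mul n M w _ ρ, koff_add_unitVec_of_lt n M w x ρ hlt', hd', Pfac_add_unitVec_of_lt n M w x ρ hlt', hkoff]
    have hchi : chi n M w x = psi n (k ρ) (j ρ : ℕ) * Pfac n M w x ρ := by rw [chi_eq_mul n M w x ρ, hkoff, hdig]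
    refine prod_rule_sq n hn ?_ ?_
    · rw [abs_of_nonneg (chi_nonneg n M w _)]; exact chi_le_one n M w _
    · rw [hchi', hchi, ← sub_mul, abs_mul, abs_of_nonneg (Pfac_nonneg n M w x ρ)]
      calc |psi n (k ρ) ((j ρ : ℕ) + 1) - psi n (k ρ) (j ρ : ℕ)| * Pfac n M w x ρ
          ≤ 1 / n * 1 := mul_le_mul (psi_step_le n _ hlt) (Pfac_le_one n M w x ρ) (Pfac_nonneg n M w x ρ) (by positivity)
        _ = 1 / n := mul_one _
  · -- crossing a face
    rw [Dterm, if_neg hlt, mul_zero, zero_add]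
    have heq : (j ρ : ℕ) + 1 = n := by have := (j ρ).isLt; omega
    have heq' : (digits n M x ρ : ℕ) + 1 = n := by rw [hdig]; exact heq
    by_cases hk2 : (k ρ : ℕ) = 2
    · -- leaving the collar: both ends vanish
      have h0 : chi n M w x = 0 := chi_eq_zero_of n M w x (ν := ρ) (by rw [hkoff, hdig, hk2]; exact psi_two_last n heq)
      have h0' : chi n M w (x + unitVec (fine n M) ρ) = 0 := by
        rcases koff_add_unitVec_of_eq n M w hM2 x ρ heq' with h3 | ⟨h00, -⟩
        · exact chi_eq_zero_of n M w _ (ν := ρ) (psi_of_three_le n (by rw [h3, hkoff, hk2]) _)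
        · refine chi_eq_zero_of n M w _ (ν := ρ) ?_
          rw [h00, digits_add_unitVec_of_eq n M x ρ heq', Function.update_self, Fin.val_zero, psi_zero_zero]
      rw [lift, lift, h0, h0', Complex.ofReal_zero, zero_mul, zero_mul, sub_zero, norm_zero]
      have : (0 : ℝ) ≤ 2 * ‖g (fold n M w x)‖ ^ 2 := by positivity
      simp [this]
    · -- crossing an interface inside the collar: `F` does not move, `χ` moves by at most `1/n`
      have hk : (k ρ : ℕ) + 1 < 3 := by have := (k ρ).isLt; omega
      have hF : fold n M w (x + unitVec (fine n M) ρ) = fold n M w x := fold_cross n M w hM3 k j ρ heq hk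
      have hko : koff n M w (x + unitVec (fine n M) ρ) ρ = (k ρ : ℕ) + 1 := by
        rcases koff_add_unitVec_of_eq n M w hM2 x ρ heq' with h3 | ⟨-, hwrap⟩
        · rw [h3, hkoff]
        · exfalso; rw [hkoff] at hwrap; have := hM3 ρ; omega
      have hchi' : chi n M w (x + unitVec (fine n M) ρ) = psi n ((k ρ : ℕ) + 1) 0 * Pfac n M w x ρ := by
        rw [chi_eq_mul n M w _ ρ, hko, digits_add_unitVec_of_eq n M x ρ heq', Function.update_self, Fin.val_zero,
          Pfac_add_unitVec_of_eq n M w x ρ heq']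
      have hchi : chi n M w x = psi n (k ρ) (j ρ : ℕ) * Pfac n M w x ρ := by rw [chi_eq_mul n M w x ρ, hkoff, hdig]
      have h := prod_rule_sq n hn (a := g (fold n M w x)) (a' := g (fold n M w (x + unitVec (fine n M) ρ)))
        (c := chi n M w x) (c' := chi n M w (x + unitVec (fine n M) ρ)) ?_ ?_
      · rw [hF, sub_self, norm_zero] at h
        rw [lift, lift, hF]
        nlinarith [h]
      · rw [abs_of_nonneg (chi_nonneg n M w _)]; exact chi_le_one n M w _
      · rw [hchi', hchi, ← sub_mul, abs_mul, abs_of_nonneg (Pfac_nonneg n M w x ρ)]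
        calc |psi n ((k ρ : ℕ) + 1) 0 - psi n (k ρ) (j ρ : ℕ)| * Pfac n M w x ρ
            ≤ 1 / n * 1 := mul_le_mul (psi_cross_le n hk heq) (Pfac_le_one n M w x ρ) (Pfac_nonneg n M w x ρ) (by positivity)
          _ = 1 / n := mul_one _

/-- **OFF THE COLLAR THE LIFT HAS NO GRADIENT**: both endpoints of a bond starting outside the collar carry `lift = 0`. [folklore] -/
theorem lift_step_of_not_mem (hM3 : ∀ μ, 3 ≤ M μ) (g : Tor (fine n M) → ℂ) {x : Tor (fine n M)} (hx : x ∉ collar n M w)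
    (ρ : Fin d) : lift n M w g (x + unitVec (fine n M) ρ) - lift n M w g x = 0 := by
  have hM2 : ∀ μ, 2 ≤ M μ := fun μ => le_of_lt (hM3 μ)
  rw [lift_of_not_mem n M w g hx, sub_zero]
  simp only [mem_collar, not_forall, not_lt] at hx
  obtain ⟨ν, hν⟩ := hx
  rw [lift]
  suffices h : chi n M w (x + unitVec (fine n M) ρ) = 0 by rw [h, Complex.ofReal_zero, zero_mul]
  by_cases hνρ : ν = ρ
  · subst hνρ
    by_cases hlt : (digits n M x ν : ℕ) + 1 < n
    · exact chi_eq_zero_of n M w _ (ν := ν) (psi_of_three_le n (by rw [koff_add_unitVec_of_lt n M w x ν hlt]; exact hν) _)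
    · have heq : (digits n M x ν : ℕ) + 1 = n := by have := (digits n M x ν).isLt; omega
      rcases koff_add_unitVec_of_eq n M w hM2 x ν heq with h3 | ⟨h00, -⟩
      · exact chi_eq_zero_of n M w _ (ν := ν) (psi_of_three_le n (by rw [h3]; omega) _)
      · refine chi_eq_zero_of n M w _ (ν := ν) ?_
        rw [h00, digits_add_unitVec_of_eq n M x ν heq, Function.update_self, Fin.val_zero, psi_zero_zero]
  · exact chi_eq_zero_of n M w _ (ν := ν) (psi_of_three_le n (by rw [koff_add_unitVec_of_ne n M w x hνρ]; exact hν) _)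

end Summit.QuantumFields.BalabanUV.T4Continuum.RegionCollarCutoff

end
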